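import Summits.FinalStateConjecture.FinalStateConjecture.Theorems.PhotonSphereChannelsUniformPhotonSphereChannelsRChainBookkeeping
import Summits.FinalStateConjecture.FinalStateConjecture.Theorems.PhotonSphereChannelsUniformPhotonSphereChannelsRRungZeroMajorant
import Summits.FinalStateConjecture.FinalStateConjecture.Theorems.PhotonSphereChannelsUniformPhotonSphereChannelsRQFormRecursion
import Summits.FinalStateConjecture.FinalStateConjecture.Theorems.PhotonSphereChannelsUniformPhotonSphereChannelsRConvolutionBounds
import Summits.FinalStateConjecture.FinalStateConjecture.Theorems.PhotonSphereChannelsUniformPhotonSphereChannelsRMajorantHStep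

/-!
# Crux `UniformPhotonSphereChannelsR` (K1R, stmt-FinalStateConjecture-14074), line
# `crum-peeling-recessive-tower` — Theorem A assembled: `stub_rungStepMajorant` (A3) and `stub_coeffMajorant`

The uniform majorant of the Taylor coefficients of the recessive Riccati–Crum chain
(`g_k = 1/ω_k = Σ G k n wⁿ`, `ω_k = Σ Ω k n wⁿ`): `|G k 1| ≤ K(1+log(ℓ+1))`,
`|G k n| ≤ (K(1+log(ℓ+1)))^{n−1}`, `|Ω k n| ≤ (K(1+log(ℓ+1)))ⁿ` with the ABSOLUTE constant
`K = 2·10⁵`, for all rungs `k < ℓ` (`s ≤ 2`, `s ≤ ℓ`, `1 ≤ ℓ`), by induction on the rung: base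
`stub_rungZeroMajorant` (A4), step `stub_qFormRecursion` (A1, exact q-form) +
`stub_rungStepMajorant` (A3, fed with the convolution inequalities `stub_convolutionBounds`, A2a),
carrying `B_{k+1} = B_k + Δ_{ℓ−k}`, `θ_{k+1} = θ_k (1 − 2/(2(ℓ−k)−1)²)` from `B₀ = 16`, `θ₀ = 2⁻¹⁰`;
export by `stub_chainBookkeeping` (A2b: `Π (1 − 2/(2λ_j−1)²) ≥ 4/9`, `Σ Δ ≤ 1 + 2 log(ℓ+1)`,
inversion majorant).  This is where the log-ball radius `C log(ℓ+1)` of K1R comes from.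
-/

set_option linter.dupNamespace false

noncomputable section

namespace Summit.FinalStateConjecture.FinalStateConjecture.Theorems.CrumPeelingRecessiveTower

/-! ### The registered stub A3: `stub_rungStepMajorant` -/

section Assembly

set_option maxHeartbeats 800000 in
/-- **Theorem A, rung step (stub A3 of the line `crum-peeling-recessive-tower`).**
If the Taylor coefficients `Gk` of `g_k = 1/ω_k` at the horizon satisfy the profile majorant
`|Gk n| ≤ 2 (B/θ)^(n-1)/n²` (`n ≥ 2`, `|Gk 1| ≤ B`, `16 ≤ B`, `θ ≤ 1/1024`), then the coefficients
`Gk1` of the next rung `g_{k+1} = g_k − ω_k + 2(1−2w) ω_k'` — expressed through the exact q-form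
`(Hq)`/`(Qn)` with `λ = ℓ − k ≥ 2` — satisfy the same majorant with the drifted constants
`B' = B + Δ_λ`, `θ' = θ (1 − 2/(2λ−1)²)`.  The five convolution inequalities are the first
hypothesis (stub A2a). -/
theorem stub_rungStepMajorant :
    ((∀ (lam : ℝ) (n : ℕ), 2 ≤ lam → 2 ≤ n →
        ∑ i ∈ Finset.Ico 2 n, (1 / ((i : ℝ) ^ 2)) * (1 / ((((n - i : ℕ) : ℝ)) * (2 * lam - 1 + ((n - i : ℕ) : ℝ))))
          ≤ 16 * (((n : ℝ) - 1) / n) * (1 / ((n : ℝ) * (2 * lam - 1 + n)))) ∧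
    (∀ (lam : ℝ) (m : ℕ), 2 ≤ lam → 2 ≤ m →
        ∑ i ∈ Finset.Ico 1 m, (1 / ((i : ℝ) * (2 * lam - 1 + i))) * (1 / ((((m - i : ℕ) : ℝ)) * (2 * lam - 1 + ((m - i : ℕ) : ℝ))))
          ≤ (16 / 3) * (1 / ((m : ℝ) * (2 * lam - 1 + m))) * (1 + Real.log (2 * lam)) / lam) ∧
    (∀ (lam : ℝ) (n : ℕ), 2 ≤ lam → 1 ≤ n →
        (n : ℝ) * ∑ i ∈ Finset.Ico 1 n, (1 / (i : ℝ)) * (1 / ((((n - i : ℕ) : ℝ)) * (2 * lam - 1 + ((n - i : ℕ) : ℝ)))) ≤ 4) ∧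
    (∀ (lam : ℝ) (n : ℕ), 2 ≤ lam → 2 ≤ n →
        ∑ i ∈ Finset.Ico 2 n, (1 / ((i : ℝ) ^ 2)) * (1 / (2 * lam - 1 + ((n - i : ℕ) : ℝ))) ≤ 3 / (2 * lam - 1 + n)) ∧
    (∀ (lam n : ℕ), 2 ≤ lam → 2 * lam ≤ n →
        3 * (lam : ℝ) / (2 * (lam : ℝ) - 1 + n)
          ≤ 2 * ((n : ℝ) - 1) / (2 * (lam : ℝ) - 1) ^ 2 + 1
            - (lam : ℝ) * ((n : ℝ) + 1 - 2 * lam) / (((lam : ℝ) - 1) * (2 * (lam : ℝ) - 1 + n)))) →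
    ∀ (ℓ k : ℕ), k + 2 ≤ ℓ → ∀ (θ B : ℝ) (Gk Gk1 q α : ℕ → ℝ),
      0 < θ → θ ≤ 1 / 1024 → 16 ≤ B → |Gk 1| ≤ B → Gk 0 = 1 →
      α 0 = 0 → α 1 = -2 →
      (∀ n, 2 ≤ n → α n = (1 - (n : ℝ)) * Gk n + 2 * ((n : ℝ) - 2) * Gk (n - 1)) →
      q 0 = 0 → q 1 = -((2 * ((ℓ : ℝ) - k) - 1) / (((ℓ : ℝ) - k) * (((ℓ : ℝ) - k) - 1))) →
      (∀ n, 2 ≤ n → Gk1 n = Gk n + q n + Gk 1 * q (n - 1) + ∑ i ∈ Finset.Ico 2 n, Gk i * q (n - i)) →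
      (∀ n, 2 ≤ n →
        (((ℓ : ℝ) - k) - 1) * (2 * ((ℓ : ℝ) - k) - 1 + n) * q n
          = (2 * ((ℓ : ℝ) - k) - 1) * α n
            - (((ℓ : ℝ) - k) - 1) * Gk 1 * ((n : ℝ) - 1) * q (n - 1)
            - (((ℓ : ℝ) - k) - 1) * ∑ i ∈ Finset.Ico 2 n, Gk i * ((n : ℝ) - i) * q (n - i)
            + 2 * (((ℓ : ℝ) - k) - 1) * (((n : ℝ) - 1) * q (n - 1) + Gk 1 * ((n : ℝ) - 2) * q (n - 2)
                + ∑ i ∈ Finset.Ico 2 (n - 1), Gk i * ((n : ℝ) - 1 - i) * q (n - 1 - i))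
            - ((ℓ : ℝ) - k) * (((ℓ : ℝ) - k) - 1) * ∑ i ∈ Finset.Ico 1 n, q i * q (n - i)
            + (3 * ((ℓ : ℝ) - k) - 1) * ∑ i ∈ Finset.Ico 1 n, α i * q (n - i)
            + ((ℓ : ℝ) - k) * ∑ i ∈ Finset.Ico 1 (n - 1), α i * ∑ j ∈ Finset.Ico 1 (n - i), q j * q (n - i - j)) →
      (∀ n, 2 ≤ n → |Gk n| ≤ 2 * (B / θ) ^ (n - 1) / (n : ℝ) ^ 2) →
      ∀ n, 2 ≤ n → |Gk1 n| ≤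
        2 * ((B + (2 * ((ℓ : ℝ) - k) - 1) / (((ℓ : ℝ) - k) * (((ℓ : ℝ) - k) - 1)))
              / (θ * (1 - 2 / (2 * ((ℓ : ℝ) - k) - 1) ^ 2))) ^ (n - 1) / (n : ℝ) ^ 2 := by
  intro hCV ℓ k hkℓ θ B Gk Gk1 q α hθ0 hθle hB hG1 _hG0 _hα0 hα1 hα _hq0 hq1 hHq hQn hInv n hn
  obtain ⟨hCV1, hCV2, hCV3, hCV4, hGc⟩ := hCV
  set lam : ℝ := (ℓ : ℝ) - k with hlamdef
  have hLnat : (((ℓ - k : ℕ)) : ℝ) = lam := by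
    rw [hlamdef, Nat.cast_sub (by omega)]
  have hlam : 2 ≤ lam := by
    rw [← hLnat]; exact_mod_cast (by omega : 2 ≤ ℓ - k)
  have hl0 : 0 < lam := by linarith
  have hl1 : 0 < lam - 1 := by linarith
  have hB0 : 0 < B := by linarith
  -- the scaled radius
  set ρ : ℝ := θ / B with hρdef
  have hρ0 : 0 < ρ := div_pos hθ0 hB0
  have hρB : ρ * B = θ := by rw [hρdef]; field_simp
  have hθ' : |Gk 1| * ρ ≤ θ := by
    calc |Gk 1| * ρ ≤ B * ρ := mul_le_mul_of_nonneg_right hG1 hρ0.le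
      _ = θ := by rw [mul_comm]; exact hρB
  have hGs : ∀ i, 2 ≤ i → |Gk i| * ρ ^ i ≤ 2 * ρ / (i : ℝ) ^ 2 := by
    intro i hi
    have h := hInv i hi
    have hpow : ρ ^ i = ρ ^ (i - 1) * ρ := by
      rw [← pow_succ]; congr 1; omega
    have hone : (B / θ) ^ (i - 1) * ρ ^ (i - 1) = 1 := by
      rw [← mul_pow, hρdef, div_mul_div_comm, mul_comm B θ, div_self (mul_pos hθ0 hB0).ne', one_pow]
    have hi0 : (0 : ℝ) < (i : ℝ) ^ 2 := by positivity
    calc |Gk i| * ρ ^ i ≤ (2 * (B / θ) ^ (i - 1) / (i : ℝ) ^ 2) * ρ ^ i :=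
          mul_le_mul_of_nonneg_right h (pow_nonneg hρ0.le i)
      _ = 2 * ((B / θ) ^ (i - 1) * ρ ^ (i - 1)) * ρ / (i : ℝ) ^ 2 := by rw [hpow]; ring
      _ = 2 * ρ / (i : ℝ) ^ 2 := by rw [hone, mul_one]
  have hGc' : ∀ m : ℕ, 2 * (ℓ - k) ≤ m → 3 * lam / (2 * lam - 1 + m)
      ≤ 2 * ((m : ℝ) - 1) / (2 * lam - 1) ^ 2 + 1
        - lam * ((m : ℝ) + 1 - 2 * lam) / ((lam - 1) * (2 * lam - 1 + m)) := by
    intro m hm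
    have h := hGc (ℓ - k) m (by omega) hm
    rw [hLnat] at h
    exact h
  have hmain := H_scaled_le (H := Gk1) hlam hLnat hρ0 hB hρB hθle hθ' hGs hα1 hα hq1 hQn hHq
    (fun m hm => hCV1 lam m hlam hm) (fun m hm => hCV2 lam m hlam hm)
    (fun m hm => hCV3 lam m hlam hm) (fun m hm => hCV4 lam m hlam hm) hGc' n hn
  -- unscale
  have hρn : 0 < ρ ^ n := pow_pos hρ0 n
  rw [← le_div_iff₀ hρn] at hmain
  refine hmain.trans (le_of_eq ?_)
  have hτ0 : 0 < 1 - 2 / (2 * lam - 1) ^ 2 := by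
    have h9 : (9 : ℝ) ≤ (2 * lam - 1) ^ 2 := by
      have h3 : (3 : ℝ) ≤ 2 * lam - 1 := by linarith
      calc (9 : ℝ) = 3 * 3 := by norm_num
        _ ≤ (2 * lam - 1) * (2 * lam - 1) := mul_le_mul h3 h3 (by norm_num) (by linarith)
        _ = (2 * lam - 1) ^ 2 := by ring
    rw [sub_pos, div_lt_one (by positivity)]; linarith
  set σ : ℝ := (1 + (2 * lam - 1) / (lam * (lam - 1)) / B) / (1 - 2 / (2 * lam - 1) ^ 2) with hσdef
  have hσ : (B + (2 * lam - 1) / (lam * (lam - 1))) / (θ * (1 - 2 / (2 * lam - 1) ^ 2)) = σ / ρ := by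
    rw [hσdef, hρdef]
    field_simp
  have hpow : ρ ^ n = ρ ^ (n - 1) * ρ := by
    rw [← pow_succ]; congr 1; omega
  clear_value σ
  rw [hσ, div_pow σ ρ (n - 1), hpow]
  have hR0 : ρ ^ (n - 1) ≠ 0 := pow_ne_zero _ hρ0.ne'
  generalize ρ ^ (n - 1) = R at hR0 ⊢
  generalize σ ^ (n - 1) = S
  have hn0 : (n : ℝ) ≠ 0 := by
    have : (2 : ℝ) ≤ n := by exact_mod_cast hn
    positivity
  have hρne : ρ ≠ 0 := hρ0.ne'
  field_simp

end Assembly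

/-- **Theorem A reassembled (PROVED): the registered signature of `stub_coeffMajorant` from A1–A4 and A2b** —
induction on the rung `k` carrying the shift law `G k 1 = G 0 1 − Σ_{j<k} Δ_{ℓ−j}` and the majorant
`|G k n| ≤ 2(B_k/θ_k)^{n−1}/n²` with `B_0 = 16`, `B_{k+1} = B_k + Δ_{ℓ−k}`, `θ_0 = 2^{−10}`, `θ_{k+1} = θ_k(1 − 2/(2(ℓ−k)−1)²)`
(base A4, step A1 + A3), then the export with `R := 2B_k/θ_k ≤ 10⁵(1 + log(ℓ+1))` (A2b) and `K = 2·10⁵`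
(`|Ω k n| ≤ (4B_k/θ_k)ⁿ` by the inversion majorant). -/
theorem stub_coeffMajorant :
    ∃ K : ℝ, 1 ≤ K ∧ ∀ (s ℓ : ℕ), s ≤ 2 → s ≤ ℓ → 1 ≤ ℓ → ∀ (Ω G : ℕ → ℕ → ℝ),
      (∀ k, Ω k 0 = 1) → (∀ k, G k 0 = 1) →
      (∀ k n, ∑ i ∈ Finset.range (n + 1), G k i * Ω k (n - i) = if n = 0 then 1 else 0) →
      (∀ n, (ℓ : ℝ) ^ 2 * ∑ i ∈ Finset.range (n + 1), Ω 0 i * Ω 0 (n - i)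
          + (ℓ : ℝ) * (((n : ℝ) + 1) * Ω 0 n - 2 * (n : ℝ) * Ω 0 (n - 1))
          = (if n = 0 then (ℓ : ℝ) * ((ℓ : ℝ) + 1)
             else if n = 1 then 2 * (1 - (s : ℝ) ^ 2) - 2 * ((ℓ : ℝ) * ((ℓ : ℝ) + 1))
             else if n = 2 then -(4 * (1 - (s : ℝ) ^ 2)) else 0)) →
      (∀ k, k + 2 ≤ ℓ → ∀ n,
          ((ℓ : ℝ) - k - 1) ^ 2 * ∑ i ∈ Finset.range (n + 1), Ω (k + 1) i * Ω (k + 1) (n - i)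
          + ((ℓ : ℝ) - k - 1) * (((n : ℝ) + 1) * Ω (k + 1) n - 2 * (n : ℝ) * Ω (k + 1) (n - 1))
          = ((ℓ : ℝ) - k) ^ 2 * ∑ i ∈ Finset.range (n + 1), Ω k i * Ω k (n - i)
          - ((ℓ : ℝ) - k) * (((n : ℝ) + 1) * Ω k n - 2 * (n : ℝ) * Ω k (n - 1))) →
      ∀ k, k + 1 ≤ ℓ →
        |G k 1| ≤ K * (1 + Real.log ((ℓ : ℝ) + 1)) ∧
        (∀ n, 2 ≤ n → |G k n| ≤ (K * (1 + Real.log ((ℓ : ℝ) + 1))) ^ (n - 1)) ∧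
        (∀ n, |Ω k n| ≤ (K * (1 + Real.log ((ℓ : ℝ) + 1))) ^ n) := by
  refine ⟨200000, by norm_num, ?_⟩
  intro s ℓ hs hsℓ hℓ Ω G hΩ0 hG0 hinv hR0 hRK
  obtain ⟨hP1, hP2, hP3⟩ := stub_chainBookkeeping
  -- the bookkeeping functions
  obtain ⟨Δ, hΔ⟩ : ∃ Δ : ℕ → ℝ, ∀ j, Δ j = (2 * ((ℓ : ℝ) - j) - 1) / (((ℓ : ℝ) - j) * (((ℓ : ℝ) - j) - 1)) :=
    ⟨_, fun j => rfl⟩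
  obtain ⟨τ, hτ⟩ : ∃ τ : ℕ → ℝ, ∀ j, τ j = 1 - 2 / (2 * ((ℓ : ℝ) - j) - 1) ^ 2 := ⟨_, fun j => rfl⟩
  obtain ⟨Bc, hBc⟩ : ∃ Bc : ℕ → ℝ, ∀ k, Bc k = 16 + ∑ j ∈ Finset.range k, Δ j := ⟨_, fun k => rfl⟩
  obtain ⟨θc, hθc⟩ : ∃ θc : ℕ → ℝ, ∀ k, θc k = (1 / 1024) * ∏ j ∈ Finset.range k, τ j :=
    ⟨_, fun k => rfl⟩
  -- elementary facts on `Δ j`, `τ j` for `λ = ℓ - j ≥ 2`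
  have hlam : ∀ j, j + 2 ≤ ℓ → (2 : ℝ) ≤ (ℓ : ℝ) - j := fun j hj => by
    have : ((j : ℝ) + 2) ≤ ℓ := by exact_mod_cast hj
    linarith
  have hΔnn : ∀ j, j + 2 ≤ ℓ → 0 ≤ Δ j := fun j hj => by
    rw [hΔ]
    have h2 := hlam j hj
    apply div_nonneg <;> nlinarith
  have hτbd : ∀ j, j + 2 ≤ ℓ → 7 / 9 ≤ τ j ∧ τ j ≤ 1 := fun j hj => by
    rw [hτ]
    have h2 := hlam j hj
    have h3 : (3 : ℝ) ≤ 2 * ((ℓ : ℝ) - j) - 1 := by linarith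
    have h9 : (9 : ℝ) ≤ (2 * ((ℓ : ℝ) - j) - 1) ^ 2 := by nlinarith
    constructor
    · have : 2 / (2 * ((ℓ : ℝ) - j) - 1) ^ 2 ≤ 2 / 9 :=
        div_le_div_of_nonneg_left (by norm_num) (by norm_num) h9
      linarith
    · have : 0 ≤ 2 / (2 * ((ℓ : ℝ) - j) - 1) ^ 2 := by positivity
      linarith
  have hBc_ge : ∀ k, k + 1 ≤ ℓ → 16 ≤ Bc k := fun k hk => by
    rw [hBc]
    have : 0 ≤ ∑ j ∈ Finset.range k, Δ j :=
      Finset.sum_nonneg fun j hj => hΔnn j (by have := Finset.mem_range.1 hj; omega)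
    linarith
  have hθc_pos : ∀ k, k + 1 ≤ ℓ → 0 < θc k ∧ θc k ≤ 1 / 1024 := fun k hk => by
    rw [hθc]
    have hmem : ∀ j ∈ Finset.range k, j + 2 ≤ ℓ := fun j hj => by
      have := Finset.mem_range.1 hj; omega
    have hprod : 0 < ∏ j ∈ Finset.range k, τ j ∧ ∏ j ∈ Finset.range k, τ j ≤ 1 := by
      refine ⟨Finset.prod_pos fun j hj => ?_, Finset.prod_le_one (fun j hj => ?_) fun j hj => ?_⟩
      · have := (hτbd j (hmem j hj)).1; linarith
      · have := (hτbd j (hmem j hj)).1; linarith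
      · exact (hτbd j (hmem j hj)).2
    constructor
    · exact mul_pos (by norm_num) hprod.1
    · have := mul_le_mul_of_nonneg_left hprod.2 (by norm_num : (0 : ℝ) ≤ 1 / 1024)
      linarith
  -- the base rung
  obtain ⟨hG01, hG01nn, hG01le, hbase⟩ :=
    stub_rungZeroMajorant s ℓ hs hsℓ hℓ Ω G (hΩ0 0) (hG0 0) (hinv 0) hR0
  -- the induction along the chain
  have main : ∀ k, k + 1 ≤ ℓ →
      (G k 1 = G 0 1 - ∑ j ∈ Finset.range k, Δ j) ∧
      (∀ n, 2 ≤ n → |G k n| ≤ 2 * (Bc k / θc k) ^ (n - 1) / (n : ℝ) ^ 2) := by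
    intro k
    induction k with
    | zero =>
      intro _
      refine ⟨by simp, fun n hn => ?_⟩
      have h := hbase n hn
      have hq : Bc 0 / θc 0 = 16384 := by
        rw [hBc, hθc]; simp; norm_num
      rw [hq]
      exact h
    | succ k ih =>
      intro hk1
      obtain ⟨hSh, hInv⟩ := ih (by omega)
      -- the q- and α-sequences of rung k
      obtain ⟨q, hq⟩ : ∃ q : ℕ → ℝ, ∀ n,
          q n = (∑ i ∈ Finset.range (n + 1), G (k + 1) i * Ω k (n - i)) - if n = 0 then 1 else 0 :=
        ⟨_, fun n => rfl⟩
      obtain ⟨α, hα0, hα1, hα⟩ : ∃ α : ℕ → ℝ, α 0 = 0 ∧ α 1 = -2 ∧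
          ∀ n, 2 ≤ n → α n = (1 - (n : ℝ)) * G k n + 2 * ((n : ℝ) - 2) * G k (n - 1) := by
        refine ⟨fun n => if n = 0 then 0 else if n = 1 then -2
          else (1 - (n : ℝ)) * G k n + 2 * ((n : ℝ) - 2) * G k (n - 1), by simp, by simp, fun n hn => ?_⟩
        simp only
        rw [if_neg (by omega), if_neg (by omega)]
      obtain ⟨hq0, hq1, hshift, hHq, hQn⟩ :=
        stub_qFormRecursion ℓ k hk1 Ω G (hΩ0 k) (hΩ0 (k + 1)) (hG0 k) (hG0 (k + 1)) (hinv k)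
          (hinv (k + 1)) (hRK k hk1) q α hq hα0 hα1 hα
      refine ⟨?_, ?_⟩
      · rw [hshift, hSh, Finset.sum_range_succ, hΔ k]
        ring
      · obtain ⟨hθpos, hθle⟩ := hθc_pos k (by omega)
        have hB16 := hBc_ge k (by omega)
        have hS : 0 ≤ ∑ j ∈ Finset.range k, Δ j :=
          Finset.sum_nonneg fun j hj => hΔnn j (by have := Finset.mem_range.1 hj; omega)
        have hãB : |G k 1| ≤ Bc k := by
          rw [hSh, hBc]
          rcases le_or_gt 0 (G 0 1 - ∑ j ∈ Finset.range k, Δ j) with h | h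
          · rw [abs_of_nonneg h]; linarith
          · rw [abs_of_neg h]; linarith
        have step := stub_rungStepMajorant stub_convolutionBounds ℓ k hk1 (θc k) (Bc k) (G k) (G (k + 1)) q α hθpos hθle hB16
          hãB (hG0 k) hα0 hα1 hα hq0 hq1 hHq hQn hInv
        intro n hn
        have h := step n hn
        have hB' : Bc k + (2 * ((ℓ : ℝ) - k) - 1) / (((ℓ : ℝ) - k) * (((ℓ : ℝ) - k) - 1)) = Bc (k + 1) := by
          rw [hBc (k + 1), Finset.sum_range_succ, ← hΔ k, hBc k]; ring
        have hθ' : θc k * (1 - 2 / (2 * ((ℓ : ℝ) - k) - 1) ^ 2) = θc (k + 1) := by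
          rw [hθc (k + 1), Finset.prod_range_succ, ← hτ k, hθc k]; ring
        rw [hB', hθ'] at h
        exact h
  -- the export
  intro k hk
  obtain ⟨hSh, hInv⟩ := main k hk
  obtain ⟨hθpos, hθle⟩ := hθc_pos k hk
  have hB16 := hBc_ge k hk
  have hS : 0 ≤ ∑ j ∈ Finset.range k, Δ j :=
    Finset.sum_nonneg fun j hj => hΔnn j (by have := Finset.mem_range.1 hj; omega)
  have hãB : |G k 1| ≤ Bc k := by
    rw [hSh, hBc]
    rcases le_or_gt 0 (G 0 1 - ∑ j ∈ Finset.range k, Δ j) with h | h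
    · rw [abs_of_nonneg h]; linarith
    · rw [abs_of_neg h]; linarith
  -- size of `Bc k` and `θc k`
  have hlog0 : 0 ≤ Real.log (ℓ : ℝ) := Real.log_nonneg (by exact_mod_cast hℓ)
  have hlog1 : Real.log (ℓ : ℝ) ≤ Real.log ((ℓ : ℝ) + 1) :=
    Real.log_le_log (by exact_mod_cast (show 0 < ℓ by omega)) (by linarith)
  have hlog2 : 0 ≤ Real.log ((ℓ : ℝ) + 1) := hlog0.trans hlog1
  have hBle : Bc k ≤ 17 + 2 * Real.log ((ℓ : ℝ) + 1) := by
    have h := hP2 ℓ k hk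
    rw [hBc]
    have : ∑ j ∈ Finset.range k, Δ j =
        ∑ j ∈ Finset.range k, (2 * ((ℓ : ℝ) - j) - 1) / (((ℓ : ℝ) - j) * (((ℓ : ℝ) - j) - 1)) :=
      Finset.sum_congr rfl fun j _ => hΔ j
    rw [this]
    linarith
  have hθge : (1 / 1024) * (4 / 9) ≤ θc k := by
    have h := hP1 ℓ k hk
    rw [hθc]
    have : ∏ j ∈ Finset.range k, τ j = ∏ j ∈ Finset.range k, (1 - 2 / (2 * ((ℓ : ℝ) - j) - 1) ^ 2) :=
      Finset.prod_congr rfl fun j _ => hτ j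
    rw [this]
    exact mul_le_mul_of_nonneg_left h (by norm_num)
  -- the radius `A = 2 Bc k / θc k` and the uniform `R`
  have hA1 : 1 ≤ Bc k / θc k := by
    rw [le_div_iff₀ hθpos]; linarith
  obtain ⟨A, hA⟩ : ∃ A : ℝ, A = 2 * (Bc k / θc k) := ⟨_, rfl⟩
  have hA1' : 1 ≤ A := by rw [hA]; linarith
  have hA0 : 0 ≤ A := zero_le_one.trans hA1'
  have hBA : Bc k ≤ A := by
    rw [hA]
    have : Bc k ≤ Bc k / θc k := by
      rw [le_div_iff₀ hθpos]
      have : Bc k * θc k ≤ Bc k * 1 := mul_le_mul_of_nonneg_left (by linarith) (by linarith)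
      linarith
    linarith
  obtain ⟨R, hR⟩ : ∃ R : ℝ, R = 200000 * (1 + Real.log ((ℓ : ℝ) + 1)) := ⟨_, rfl⟩
  have hA_le : 2 * A ≤ R := by
    -- 4 Bc/θc ≤ 4 (17 + 2 log(ℓ+1)) / ((1/1024)(4/9)) = 9216 (17 + 2 log(ℓ+1)) ≤ 200000 (1 + log(ℓ+1))
    rw [hA, hR]
    have hq : Bc k / θc k ≤ (17 + 2 * Real.log ((ℓ : ℝ) + 1)) / ((1 / 1024) * (4 / 9)) := by
      rw [div_le_div_iff₀ hθpos (by norm_num)]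
      have h1 : Bc k * ((1 / 1024) * (4 / 9)) ≤ (17 + 2 * Real.log ((ℓ : ℝ) + 1)) * ((1 / 1024) * (4 / 9)) :=
        mul_le_mul_of_nonneg_right hBle (by norm_num)
      have h2 : (17 + 2 * Real.log ((ℓ : ℝ) + 1)) * ((1 / 1024) * (4 / 9))
          ≤ (17 + 2 * Real.log ((ℓ : ℝ) + 1)) * θc k :=
        mul_le_mul_of_nonneg_left hθge (by linarith)
      linarith
    have : (17 + 2 * Real.log ((ℓ : ℝ) + 1)) / ((1 / 1024) * (4 / 9))
        = 2304 * (17 + 2 * Real.log ((ℓ : ℝ) + 1)) := by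
      field_simp; ring
    rw [this] at hq
    nlinarith
  have hAR : A ≤ R := by linarith
  refine ⟨?_, ?_, ?_⟩
  · -- |G k 1| ≤ Bc k ≤ A ≤ R
    rw [← hR]; exact hãB.trans (hBA.trans hAR)
  · intro n hn
    rw [← hR]
    have h := hInv n hn
    have hx : 2 * (Bc k / θc k) ^ (n - 1) / (n : ℝ) ^ 2 ≤ A ^ (n - 1) := by
      rw [div_le_iff₀ (by positivity), hA, mul_pow]
      have hn2 : (4 : ℝ) ≤ (n : ℝ) ^ 2 := by
        have : (2 : ℝ) ≤ n := by exact_mod_cast hn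
        nlinarith
      have h2n : (2 : ℝ) ≤ 2 ^ (n - 1) := by
        calc (2 : ℝ) = 2 ^ 1 := by norm_num
          _ ≤ 2 ^ (n - 1) := pow_le_pow_right₀ (by norm_num) (by omega)
      have hp : 0 ≤ (Bc k / θc k) ^ (n - 1) := by positivity
      have h8 : (8 : ℝ) ≤ 2 ^ (n - 1) * (n : ℝ) ^ 2 :=
        calc (8 : ℝ) = 2 * 4 := by norm_num
          _ ≤ 2 ^ (n - 1) * (n : ℝ) ^ 2 := mul_le_mul h2n hn2 (by norm_num) (by positivity)
      calc 2 * (Bc k / θc k) ^ (n - 1) = (Bc k / θc k) ^ (n - 1) * 2 := by ring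
        _ ≤ (Bc k / θc k) ^ (n - 1) * (2 ^ (n - 1) * (n : ℝ) ^ 2) :=
          mul_le_mul_of_nonneg_left (by linarith) hp
        _ = 2 ^ (n - 1) * (Bc k / θc k) ^ (n - 1) * (n : ℝ) ^ 2 := by ring
    have hAn : A ^ (n - 1) ≤ R ^ (n - 1) := pow_le_pow_left₀ hA0 hAR _
    exact h.trans (hx.trans hAn)
  · have hGA : ∀ n, 1 ≤ n → |G k n| ≤ A ^ n := by
      intro n hn1
      rcases Nat.lt_or_ge n 2 with hlt | hge
      · obtain rfl : n = 1 := by omega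
        rw [pow_one]; exact hãB.trans hBA
      · have h := hInv n hge
        have hx : 2 * (Bc k / θc k) ^ (n - 1) / (n : ℝ) ^ 2 ≤ A ^ (n - 1) := by
          rw [div_le_iff₀ (by positivity), hA, mul_pow]
          have hn2 : (4 : ℝ) ≤ (n : ℝ) ^ 2 := by
            have : (2 : ℝ) ≤ n := by exact_mod_cast hge
            nlinarith
          have h2n : (2 : ℝ) ≤ 2 ^ (n - 1) := by
            calc (2 : ℝ) = 2 ^ 1 := by norm_num
              _ ≤ 2 ^ (n - 1) := pow_le_pow_right₀ (by norm_num) (by omega)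
          have hp : 0 ≤ (Bc k / θc k) ^ (n - 1) := by positivity
          have h8 : (8 : ℝ) ≤ 2 ^ (n - 1) * (n : ℝ) ^ 2 :=
            calc (8 : ℝ) = 2 * 4 := by norm_num
              _ ≤ 2 ^ (n - 1) * (n : ℝ) ^ 2 := mul_le_mul h2n hn2 (by norm_num) (by positivity)
          calc 2 * (Bc k / θc k) ^ (n - 1) = (Bc k / θc k) ^ (n - 1) * 2 := by ring
            _ ≤ (Bc k / θc k) ^ (n - 1) * (2 ^ (n - 1) * (n : ℝ) ^ 2) :=
              mul_le_mul_of_nonneg_left (by linarith) hp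
            _ = 2 ^ (n - 1) * (Bc k / θc k) ^ (n - 1) * (n : ℝ) ^ 2 := by ring
        calc |G k n| ≤ A ^ (n - 1) := h.trans hx
          _ ≤ A ^ (n - 1) * A := le_mul_of_one_le_right (by positivity) hA1'
          _ = A ^ n := by rw [← pow_succ, Nat.sub_add_cancel (by omega)]
    have hΩ := hP3 (G k) (Ω k) A hA1' (hG0 k) (hΩ0 k) hGA (hinv k)
    intro n
    rw [← hR]
    refine (hΩ n).trans ?_
    exact pow_le_pow_left₀ (by positivity) hA_le _

end Summit.FinalStateConjecture.FinalStateConjecture.Theorems.CrumPeelingRecessiveTower
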